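import Summits.ResolutionOfSingularities.ResolutionOfSingularities.Theorems.DeltaCutCells
import HarnessLib

/-!
# DeltaCutCertificates — decomp-res node «DeltaCut» (lens-6 g23, critic row 181 CLEARED DECIDED +1 · MAP +1 (lane
(b))), tree file 7/8 of the node

Content VERBATIM from the decomp-res lens-6 g23 node `HOME/decomp-res-lens-6/g23/DeltaCut.lean` (pin a85f83d5) /
`DeltaCutJ.lean` (9b3a0295); imports the
landed tree only, carries nothing; HOME = run/shared/lean/pub/decomp-res; critic row 181 CLEARED DECIDED +1 · MAP +1
(lane (b)); landing orders NODE-g23.md §10 /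
INBOX :883 — provenance, critic text and the lens header in full in the first file of the node, `DeltaCutLaw`.
Namespace `…Theorems.DeltaCutClasses`;
`--supports stmt-ResolutionOfSingularities-26971`; cone-free.

## This file

§CertificatesN — INHABITANTS (kernel certificates): DECIDED side BEYOND the light cell — `R3_deltaLight [CharP K 3]`
for R3 = `z³+t²u²+t⁵+u⁵+w⁴` (in EACH of the four Rees charts and at EVERY prime some layer `k ∈ {0,1,2}` is light:
`layer0_light_of_not_mem`, `layer0_light_one`, the g22 computations on `{Z̄ = 0}`; heavy by the tree's
`LightCutMapA2.heavy_R3`); RESIDUAL side WITH ITS NEAR POINT EXHIBITED — R2 = `z³+t⁴+u²w²`: `R2_deltaHeavy_chart_u`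
(at the prime `(Z̄,T',W')` of chart `u` EVERY layer is heavy) and **`R2_near_chart_u`** (the transform `z'³ + u(w'²
+ t'⁴) ∈ 𝔫³` at the origin of chart `u`: a NEAR point; the same polynomial is the tree's TAME successor
`LightCutMapA2.tame_successor_quartic`).

[WRITER NOTE (decomp-res writer g11): file split only (tree files ≤ 400 lines); `noncomputable section`, universe,
namespace, sections, section
variables, the `open` lines and every declaration exactly as in the lens; no instance, no notation, no include/omit added.]

(Sources: Hironaka1967 (characteristic polyhedra); CossartJannsenSaito2020 Def. 3.13 / Thm. 3.14 p. 129, Ch. 8 pp.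
128–135, Thm. 9.6 p. 136; Hironaka1970 (near points / vertices); CossartPiltant2008 §2; Giraud1975; EGAIV4 §16–§17
(formal smoothness); StacksProject 0804 / 0BIQ / 031I; Matsumura1987 §28.)
-/

noncomputable section

open CategoryTheory CategoryTheory.Limits AlgebraicGeometry TopologicalSpace IsLocalRing
open Literature.AlgebraicGeometry.Resolution
universe u

open Summit.ResolutionOfSingularities.ResolutionOfSingularities.Theorems.TwistCutClasses
open Summit.ResolutionOfSingularities.ResolutionOfSingularities.Theorems.LightCutClasses

namespace Summit.ResolutionOfSingularities.ResolutionOfSingularities.Theorems.DeltaCutClasses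

section CertificatesN

open MvPolynomial
variable {K : Type*} [Field K]

/-! ### §R-c inhabitants: KERNEL CERTIFICATES — R3 is δ-LIGHT (decided side, beyond the light cell), R2 is δ-HEAVY
(residual side)

Dictionary (as in `LightCutMapA` §7 / `not_near_of_delta_light`): R3 = `z³ + t²u² + t⁵ + u⁵ + w⁴` over a field of
characteristic 3,
`n = 3`, `c = (z,t,u,w)`; ADAPTED LAYERS `E 0 = {z³}` (`|e| = 3 = n`), `E 1 = {t²u², w⁴}` (`|e| = 4 = n+1`), `E 2 = {t⁵, u⁵}`
(`|e| = 5 = n+2`), all coefficients `b = 1` (adapted for EVERY ring section `s̄`, as `s̄ 1 = 1`), remainder `0`.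
Reduced layers in the
Rees charts (variables of `MvPolynomial (Fin 3) K`: in the charts `u,t,w`: `0 = Z̄`, `1, 2` = the two remaining
parameters; in chart
`z`: `0,1,2 = T',U',W'`):
* chart `u`: `Ḡ₀ = Z̄³`, `Ḡ₁ = T'² + W'⁴`, `Ḡ₂ = T'⁵ + 1`;  chart `t`: the SAME polynomials;
* chart `w`: `Ḡ₀ = Z̄³`, `Ḡ₁ = T'²U'² + 1`, `Ḡ₂ = T'⁵ + U'⁵`;
* chart `z`: `Ḡ₀ = 1`, `Ḡ₁ = T'²U'² + W'⁴`, `Ḡ₂ = T'⁵ + U'⁵`.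
δ-light clause (`IsDeltaLight 3`, with `f :=` R3 at every `(i, 𝔮)`): at EVERY prime `𝔮` of EVERY chart SOME layer `k ∈ {0,1,2}`
has `s·Ḡ_k ∉ 𝔮^{3-k}` for all `s ∉ 𝔮` (`R3_deltaLight`); the primes `𝔮 ∌ Z̄` are settled by layer `0` alone. -/

/-- If `s ∉ 𝔮` (prime) and `s·g ∈ 𝔮²` then `g ∈ 𝔮` and `D g ∈ 𝔮` for every derivation `D`. [elementary] [folklore] -/
theorem deriv_mem_of_mul_mem_sq {R A : Type*} [CommSemiring R] [CommRing A] [Algebra R A] (𝔮 : Ideal A) [h𝔮 : 𝔮.IsPrime]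
    {s g : A} (hs : s ∉ 𝔮) (hsg : s * g ∈ 𝔮 ^ 2) (D : Derivation R A A) : g ∈ 𝔮 ∧ D g ∈ 𝔮 := by
  have h1 : s * g ∈ 𝔮 := Ideal.pow_le_self (by norm_num) hsg
  have hg : g ∈ 𝔮 := (h𝔮.mem_or_mem h1).resolve_left hs
  have h2 : D (s * g) ∈ 𝔮 := by
    have := derivation_pow_succ_mem D 𝔮 1 hsg
    rwa [pow_one] at this
  rw [Derivation.leibniz, smul_eq_mul, smul_eq_mul] at h2
  have : s * D g ∈ 𝔮 := by
    have := Ideal.sub_mem _ h2 (Ideal.mul_mem_left _ (D s) hg)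
    rwa [show s * D g + g * D s - D s * g = s * D g by ring] at this
  exact ⟨hg, (h𝔮.mem_or_mem this).resolve_left hs⟩

section chart_lemmas3

variable (K)

/-- `e_self`: Auxiliary step of this node's calculus, VERBATIM from the lens file (see the module docstring); the
statement is its type. [folklore] -/
private theorem e_self (i : Fin 3) : pderiv i (X i : MvPolynomial (Fin 3) K) = 1 := by
  classical
  exact pderiv_X_self i

/-- `e_ne`: Auxiliary step of this node's calculus, VERBATIM from the lens file (see the module docstring); the
statement is its type. [folklore] -/
private theorem e_ne {i j : Fin 3} (h : j ≠ i) : pderiv i (X j : MvPolynomial (Fin 3) K) = 0 := by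
  classical
  exact pderiv_X_of_ne h

end chart_lemmas3

/-- **R3, charts `u` and `t`** (`Ḡ₁ = X₁² + X₂⁴`, `Ḡ₂ = X₁⁵ + 1`): at every prime `𝔮`, layer 1 is light (`s·Ḡ₁ ∉ 𝔮²`) OR layer 2
is light (`s·Ḡ₂ ∉ 𝔮¹`).  (If `Ḡ₂ ∈ 𝔮` and `s Ḡ₁ ∈ 𝔮²` then `∂₁(sḠ₁) ∈ 𝔮` gives `2X₁ ∈ 𝔮`, so `X₁ ∈ 𝔮`, so `1 = Ḡ₂ - X₁⁵ ∈ 𝔮`.)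
[new; elementary] [folklore] -/
theorem deltaLight_R3_chart_ut [CharP K 3] (𝔮 : Ideal (MvPolynomial (Fin 3) K)) [𝔮.IsPrime] :
    (∀ s ∉ 𝔮, s * (X 1 ^ 2 + X 2 ^ 4 : MvPolynomial (Fin 3) K) ∉ 𝔮 ^ 2) ∨
    (∀ s ∉ 𝔮, s * (X 1 ^ 5 + 1 : MvPolynomial (Fin 3) K) ∉ 𝔮 ^ 1) := by
  classical
  by_cases h5 : (X 1 ^ 5 + 1 : MvPolynomial (Fin 3) K) ∈ 𝔮
  · left
    intro s hs hmem
    obtain ⟨-, hD⟩ := deriv_mem_of_mul_mem_sq 𝔮 hs hmem (pderiv 1)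
    have e11 := e_self K 1
    have e12 := e_ne K (i := 1) (j := 2) (by decide)
    have hd : pderiv 1 (X 1 ^ 2 + X 2 ^ 4 : MvPolynomial (Fin 3) K) = 2 * X 1 := by
      simp only [map_add, Derivation.leibniz_pow, smul_eq_mul, nsmul_eq_mul, e11, e12]
      push_cast
      ring
    rw [hd] at hD
    have hT : (X 1 : MvPolynomial (Fin 3) K) ∈ 𝔮 := (‹𝔮.IsPrime›.mem_or_mem hD).resolve_left (two_not_mem (K := K) 𝔮)
    have h1 : (1 : MvPolynomial (Fin 3) K) ∈ 𝔮 := by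
      have := Ideal.sub_mem _ h5 (Ideal.pow_mem_of_mem 𝔮 hT 5 (by norm_num))
      rwa [add_sub_cancel_left] at this
    exact ‹𝔮.IsPrime›.ne_top ((Ideal.eq_top_iff_one _).2 h1)
  · right
    intro s hs hmem
    rw [pow_one] at hmem
    exact h5 ((‹𝔮.IsPrime›.mem_or_mem hmem).resolve_left hs)

/-- **R3, chart `w`** (`Ḡ₁ = X₁²X₂² + 1`): layer 1 is light at EVERY prime (`s·Ḡ₁ ∈ 𝔮²` gives `Ḡ₁ ∈ 𝔮` and `∂₁(sḠ₁) ∈ 𝔮`, i.e.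
`2X₁X₂² ∈ 𝔮`, so `X₁²X₂² ∈ 𝔮` and `1 ∈ 𝔮`). [new; elementary] [folklore] -/
theorem deltaLight_R3_chart_w [CharP K 3] (𝔮 : Ideal (MvPolynomial (Fin 3) K)) [𝔮.IsPrime] :
    ∀ s ∉ 𝔮, s * (X 1 ^ 2 * X 2 ^ 2 + 1 : MvPolynomial (Fin 3) K) ∉ 𝔮 ^ 2 := by
  classical
  intro s hs hmem
  obtain ⟨hG, hD⟩ := deriv_mem_of_mul_mem_sq 𝔮 hs hmem (pderiv 1)
  have e11 := e_self K 1
  have e12 := e_ne K (i := 1) (j := 2) (by decide)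
  have hd : pderiv 1 (X 1 ^ 2 * X 2 ^ 2 + 1 : MvPolynomial (Fin 3) K) = 2 * (X 1 * X 2 ^ 2) := by
    simp only [map_add, Derivation.leibniz, Derivation.leibniz_pow, Derivation.map_one_eq_zero, smul_eq_mul,
      nsmul_eq_mul, e11, e12]
    push_cast
    ring
  rw [hd] at hD
  have hTU : (X 1 * X 2 ^ 2 : MvPolynomial (Fin 3) K) ∈ 𝔮 :=
    (‹𝔮.IsPrime›.mem_or_mem hD).resolve_left (two_not_mem (K := K) 𝔮)
  have hTU' : (X 1 ^ 2 * X 2 ^ 2 : MvPolynomial (Fin 3) K) ∈ 𝔮 := by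
    have := Ideal.mul_mem_left 𝔮 (X 1) hTU
    rwa [show (X 1 : MvPolynomial (Fin 3) K) * (X 1 * X 2 ^ 2) = X 1 ^ 2 * X 2 ^ 2 by ring] at this
  have h1 : (1 : MvPolynomial (Fin 3) K) ∈ 𝔮 := by
    have := Ideal.sub_mem _ hG hTU'
    rwa [add_sub_cancel_left] at this
  exact ‹𝔮.IsPrime›.ne_top ((Ideal.eq_top_iff_one _).2 h1)

/-- Layer `0` of a principal presentation (`Ḡ₀ = Z̄^n`) is δ-LIGHT at every prime NOT containing `Z̄`. [elementary]
[folklore] -/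
theorem layer0_light_of_not_mem {σ : Type*} (𝔮 : Ideal (MvPolynomial σ K)) [𝔮.IsPrime] {Z : MvPolynomial σ K}
    (hZ : Z ∉ 𝔮) {n : ℕ} (hn : 1 ≤ n) : ∀ s ∉ 𝔮, s * Z ^ n ∉ 𝔮 ^ n := by
  intro s hs hmem
  have h1 : s * Z ^ n ∈ 𝔮 := Ideal.pow_le_self (by omega) hmem
  rcases ‹𝔮.IsPrime›.mem_or_mem h1 with h | h
  · exact hs h
  · exact hZ (‹𝔮.IsPrime›.mem_of_pow_mem n h)

/-- Layer `0` in the chart of the privileged direction itself (`Ḡ₀ = 1`) is δ-light at every prime. [elementary] [folklore] -/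
theorem layer0_light_one {σ : Type*} (𝔮 : Ideal (MvPolynomial σ K)) [𝔮.IsPrime] {n : ℕ} (hn : 1 ≤ n) :
    ∀ s ∉ 𝔮, s * (1 : MvPolynomial σ K) ∉ 𝔮 ^ n := by
  intro s hs hmem
  rw [mul_one] at hmem
  exact hs (Ideal.pow_le_self (by omega) hmem)

/-- **ONE KERNEL STATEMENT — R3 IS δ-LIGHT in the IDEAL-LEVEL sense** (hence, with `heavy_R3` /
`R3_heavy_and_nearPointFree` of the
tree's `LightCutMapA2`: R3 is a HEAVY, PRINCIPAL, PERFECT wild point that the δ-cell DECIDES — the decided-side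
inhabitant BEYOND the
light cell named by row 171 (N)).  Over every field of characteristic `3`, in EACH of the FOUR Rees charts and at
EVERY prime `𝔮` of
the chart's polynomial ring, some layer `k ∈ {0, 1, 2}` of the adapted presentation of R3 (layer `0` = `Z̄³`, resp.
`1` in the chart
`z`) satisfies `∀ s ∉ 𝔮, s·Ḡᵢₖ ∉ 𝔮^{3-k}` — literally the clause of `IsDeltaLight 3` with `f :=` R3 at every `(i, 𝔮)`.  Charts `u`
and `t` give the same table (first conjunct); chart `w` the second; chart `z` (`Ḡ₀ = 1`) the third. [new;
elementary] [folklore] -/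
theorem R3_deltaLight [CharP K 3] :
    (∀ (𝔮 : Ideal (MvPolynomial (Fin 3) K)), 𝔮.IsPrime → ∃ k : ℕ, k < 3 ∧ ∀ s ∉ 𝔮,
      s * (if k = 0 then (X 0 ^ 3 : MvPolynomial (Fin 3) K) else if k = 1 then X 1 ^ 2 + X 2 ^ 4 else X 1 ^ 5 + 1) ∉
        𝔮 ^ (3 - k)) ∧
    (∀ (𝔮 : Ideal (MvPolynomial (Fin 3) K)), 𝔮.IsPrime → ∃ k : ℕ, k < 3 ∧ ∀ s ∉ 𝔮,
      s * (if k = 0 then (X 0 ^ 3 : MvPolynomial (Fin 3) K) else if k = 1 then X 1 ^ 2 * X 2 ^ 2 + 1 else X 1 ^ 5 + X 2 ^ 5) ∉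
        𝔮 ^ (3 - k)) ∧
    (∀ (𝔮 : Ideal (MvPolynomial (Fin 3) K)), 𝔮.IsPrime → ∃ k : ℕ, k < 3 ∧ ∀ s ∉ 𝔮,
      s * (if k = 0 then (1 : MvPolynomial (Fin 3) K) else if k = 1 then X 0 ^ 2 * X 1 ^ 2 + X 2 ^ 4 else X 0 ^ 5 + X 1 ^ 5) ∉
        𝔮 ^ (3 - k)) := by
  refine ⟨fun 𝔮 h𝔮 => ?_, fun 𝔮 h𝔮 => ?_, fun 𝔮 h𝔮 => ⟨0, by norm_num, ?_⟩⟩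
  · by_cases hZ : (X 0 : MvPolynomial (Fin 3) K) ∈ 𝔮
    · rcases deltaLight_R3_chart_ut (K := K) 𝔮 with h | h
      · exact ⟨1, by norm_num, by simpa using h⟩
      · exact ⟨2, by norm_num, by simpa using h⟩
    · refine ⟨0, by norm_num, ?_⟩
      simpa using layer0_light_of_not_mem (K := K) 𝔮 hZ (n := 3) (by norm_num)
  · by_cases hZ : (X 0 : MvPolynomial (Fin 3) K) ∈ 𝔮
    · exact ⟨1, by norm_num, by simpa using deltaLight_R3_chart_w (K := K) 𝔮⟩
    · refine ⟨0, by norm_num, ?_⟩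
      simpa using layer0_light_of_not_mem (K := K) 𝔮 hZ (n := 3) (by norm_num)
  · simpa using layer0_light_one (K := K) 𝔮 (n := 3) (by norm_num)

/-- **R2 IS δ-HEAVY AT AN EXPLICIT PRIME, all layers** (residual-side inhabitant; R2 = `z³ + t⁴ + u²w²`, `n = 3`, adapted layers
`E 0 = {z³}`, `E 1 = {t⁴, u²w²}`, `E 2 = ∅`; chart `u`, prime `𝔮 = (Z̄, T', W')`: `Ḡ₀ = Z̄³ ∈ 𝔮³`, `Ḡ₁ = T'⁴ + W'² ∈ 𝔮²`,
`Ḡ₂ = 0 ∈ 𝔮¹`, with `s_k = 1`).  By `transform_mem_pow_iff_delta_heavy` the transform has order `≥ 3` at the point of `𝔮`: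
the near point exhibited polynomially in `R2_near_chart_u`. [new; elementary] [folklore] -/
theorem R2_deltaHeavy_chart_u :
    (X 0 ^ 3 : MvPolynomial (Fin 3) K) ∈ (Ideal.span {(X 0 : MvPolynomial (Fin 3) K), X 1, X 2}) ^ 3 ∧
    (X 1 ^ 4 + X 2 ^ 2 : MvPolynomial (Fin 3) K) ∈ (Ideal.span {(X 0 : MvPolynomial (Fin 3) K), X 1, X 2}) ^ 2 ∧
    (0 : MvPolynomial (Fin 3) K) ∈ (Ideal.span {(X 0 : MvPolynomial (Fin 3) K), X 1, X 2}) ^ 1 := by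
  have hX : ∀ j : Fin 3, (X j : MvPolynomial (Fin 3) K) ∈ Ideal.span {(X 0 : MvPolynomial (Fin 3) K), X 1, X 2} := by
    intro j; fin_cases j <;> exact Ideal.subset_span (by simp)
  refine ⟨Ideal.pow_mem_pow (hX 0) 3, Ideal.add_mem _ ?_ (Ideal.pow_mem_pow (hX 2) 2), Submodule.zero_mem _⟩
  have h4 : (X 1 ^ 4 : MvPolynomial (Fin 3) K) = X 1 ^ 2 * X 1 ^ 2 := by ring
  rw [h4]
  exact Ideal.mul_mem_left _ _ (Ideal.pow_mem_pow (hX 1) 2)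

/-- **R2'S NEAR POINT EXHIBITED (residual-side inhabitant, kernel, polynomial level):** in chart `u` of the blow-up
of the origin
(`z = u z'`, `t = u t'`, `w = u w'`; variables `0 = z'`, `1 = t'`, `2 = u`, `3 = w'` as in
`LightCutMapA2.tame_successor_quartic`)
the transform of R2 = `z³ + t⁴ + u²w²` is `f' = z'³ + u (w'² + t'⁴) ∈ 𝔫³` for `𝔫 = (z', t', u, w')` the origin of the chart: `𝔫`
IS a NEAR point (`ord_𝔫 f' ≥ 3 = n`) — the composite «`R2_deltaHeavy_chart_u` + `transform_mem_pow_of_delta_heavy`»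
made explicit.
[new; elementary] [folklore] -/
theorem R2_near_chart_u :
    (X 0 ^ 3 + X 2 * (X 3 ^ 2 + X 1 ^ 4) : MvPolynomial (Fin 4) K) ∈
      (Ideal.span {(X 0 : MvPolynomial (Fin 4) K), X 1, X 2, X 3}) ^ 3 := by
  have hX : ∀ j : Fin 4, (X j : MvPolynomial (Fin 4) K) ∈ Ideal.span {(X 0 : MvPolynomial (Fin 4) K), X 1, X 2, X 3} := by
    intro j; fin_cases j <;> exact Ideal.subset_span (by simp)
  refine Ideal.add_mem _ (Ideal.pow_mem_pow (hX 0) 3) ?_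
  have h3 : (X 2 * (X 3 ^ 2 + X 1 ^ 4) : MvPolynomial (Fin 4) K) = X 2 * X 3 * X 3 + X 2 * X 1 * X 1 * X 1 ^ 2 := by ring
  rw [h3]
  have hp : ∀ a b c : MvPolynomial (Fin 4) K, a ∈ Ideal.span {(X 0 : MvPolynomial (Fin 4) K), X 1, X 2, X 3} →
      b ∈ Ideal.span {(X 0 : MvPolynomial (Fin 4) K), X 1, X 2, X 3} →
      c ∈ Ideal.span {(X 0 : MvPolynomial (Fin 4) K), X 1, X 2, X 3} →
      a * b * c ∈ (Ideal.span {(X 0 : MvPolynomial (Fin 4) K), X 1, X 2, X 3}) ^ 3 := by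
    intro a b c ha hb hc
    have h3 : (Ideal.span {(X 0 : MvPolynomial (Fin 4) K), X 1, X 2, X 3}) ^ 3 =
        Ideal.span {(X 0 : MvPolynomial (Fin 4) K), X 1, X 2, X 3} * Ideal.span {(X 0 : MvPolynomial (Fin 4) K), X 1, X 2, X 3} *
          Ideal.span {(X 0 : MvPolynomial (Fin 4) K), X 1, X 2, X 3} := by
      simp only [pow_succ, pow_zero, one_mul]
    rw [h3]
    exact Ideal.mul_mem_mul (Ideal.mul_mem_mul ha hb) hc
  exact Ideal.add_mem _ (hp _ _ _ (hX 2) (hX 3) (hX 3)) (Ideal.mul_mem_right _ _ (hp _ _ _ (hX 2) (hX 1) (hX 1)))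

end CertificatesN

end Summit.ResolutionOfSingularities.ResolutionOfSingularities.Theorems.DeltaCutClasses
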